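import Summits.FinalStateConjecture.FinalStateConjecture.Theses.BondiDrainDispersal
import Summits.FinalStateConjecture.FinalStateConjecture.Theorems.BondiDrainDispersalDrainImpliesDisperseStubHonestEnd
import Summits.FinalStateConjecture.FinalStateConjecture.Theorems.BondiDrainDispersalDrainImpliesDisperseReduction
import Summits.FinalStateConjecture.FinalStateConjecture.Theorems.BondiDrainDispersalDrainImpliesDisperseVisibleEnd
import Literature.Geometry.Lorentzian.LeviCivitaProofs
import Literature.Geometry.Lorentzian.NormalisedNullRayCausal
import HarnessLib.Audit

/-!
# Skeleton of line `registered` (birth; reshape r1: UNFOLDED stubs; reshape r2: (E6) no-horizon clause, stub 3 folded, stub 2 LANDED; reshape r3: REGULARITY SPLIT of the engine stub; r4: under the restated crux C″ the no-horizon clause is localised at infinity, helper LANDED p166259) — crux `BondiDrainDispersal.DrainImpliesDisperse` (stmt-FinalStateConjecture-17283)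

Registrar: planner-skel-stmt-FinalStateConjecture-17283-0, 2026-08-17 (route re-audit bin REPAIRABLE;
published as `Cruxes/DrainImpliesDisperse/Lines/birth.lean`). The crux is FIXED and concluded BY NAME:

  `Summit.FinalStateConjecture.FinalStateConjecture.Theses.BondiDrainDispersal.DrainImpliesDisperse`

(shared verbatim — `Iff.rfl`, refuter rattack-9970 — with `Theses.NoNullFinalMomentum.DrainImpliesDisperse`):
for EVERY admissible datum `D` and EVERY maximal vacuum Cauchy development `𝒟` of `D` with complete
future null infinity (sojourn form) whose final Bondi mass vanishes (`HasVanishingFinalBondiMass`, N1),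
there are `O` and a `C²` final-state decomposition `d` of `O` with `d.N = 0`,
`O = exteriorOf 𝒟 d.charted`, `RaysStayInClosure 𝒟 O`, `HasExhaustiveCharts d`, `IsFutureOriented d`
(the re-typed Statement's `N = 0` conclusion verbatim, T2).

## The cut (three named stubs along three OBJECTS; composition kernel-checked)

An honest `N = 0` decomposition is, up to the structure's bookkeeping, ONE flat late chart
`Ψ : E4 → M` (`flatDomain = ⊤`, `lateRegion_subset_flatDomain_of_N_eq_zero` /
`ofConvergesToMinkowski`): the five conjuncts of the conclusion are statements about `Ψ` and the
region `O = J⁺(ι X) ∩ I⁻(Ψ{x⁰ > τ₀})`. The proof the card foresees ("hyperboloidal Dong–Song PMT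
stability + a bubble is a hole or nothing + weak-to-`C²` upgrade", then the T2 honesty clauses) passes
through three objects, and the skeleton cuts exactly there:

* `RadiativeEnd 𝒟 τ₀ Ψ` — the ANALYTIC/TOPOLOGICAL output of the engine: a smooth chart `Ψ` of the
  flat background (domain all of `E4`) which is an open embedding of the late half-space `{x⁰ > τ₀}`
  into `J⁺(ι X)`, is PROPER on the closed half-space (`Ψ{x⁰ ≥ τ₀}` closed in `M`: the chart does not
  stop at finite distance — it reaches `i⁰`, `𝓘⁺`, `i⁺`), has FUTURE-TIMELIKE chart time
  (`Ψ_* ∂₀` future-directed timelike on `{x⁰ ≥ τ₀}`), and `C²` sup-norm decay `Ψ^* g − η → 0` on the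
  ENTIRE slabs `{x⁰ = τ} ≅ ℝ³`.  No causal clause is asserted here.
* `HonestEnd 𝒟 τ₀ Ψ` — the CAUSAL certificate the T2 clauses consume, for
  `U := Ψ{x⁰ > τ₀}`, `O := exteriorOf 𝒟 U`: (H1) `U ⊆ I⁻(U)` (so `U ⊆ O`), and (H2) exhaustion at
  EVERY chart time `τ₁ ≥ τ₀`: `O ∖ Ψ{x⁰ > τ₁} ⊆ J⁻(Ψ{x⁰ = τ₁})` (`τ₁ = τ₀` is the covering clause of
  `IsLateEmbedding`, `τ₁ > τ₀` is `HasExhaustiveCharts` at `N = 0`).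
* `CompleteRaysSignal 𝒟 U` — NO HORIZON relative to the radiative end: every point `γ t`, `t ≥ 0`,
  of every future-COMPLETE normalised null ray from the data lies in `I⁻(U)` (equivalently, by the
  down-set lemma `ray_mem_chronologicalPast_of_le`, every complete ray signals to `U` at arbitrarily
  late parameters): the set `J⁺(ι X) ∖ I⁻(U)` — the black-hole region relative to `U` — carries no
  complete ray from `Σ`.

Stubs (each a genuine lemma of the line; sizes XL / M–L / L–XL):

* `stub_radiativeEnd` (XL, the dispersal engine, card K1–K3): drain + complete `𝓘⁺` + MGHD of
  admissible data ⟹ `∃ τ₀ Ψ, RadiativeEnd 𝒟 τ₀ Ψ`.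
* `stub_honestEnd` (M–L, causal geometry, provable with the tree's causality API — no physics, no
  decay used): for EVERY Cauchy development, `RadiativeEnd 𝒟 τ₀ Ψ → HonestEnd 𝒟 τ₀ Ψ`.  (H1): the
  chart lines `s ↦ Ψ(x + s e₀)` are future timelike.  (H2): a point of `O` outside the closed set
  `C = Ψ{x⁰ ≥ τ₀}` reaches `U ⊆ C` along a timelike curve whose FIRST CONTACT with `C` is not in the
  open set `U`, hence in `Ψ{x⁰ = τ₀}`; then chart lines and transitivity of `J`
  (`causalFuture_causalFuture_holds`, time-reversed).  Why it might fail: it cannot for the intended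
  objects; if an honest dispersive development had a NON-proper global chart only, the crux is
  misstated at `RadiativeEnd` (repair: replace properness by the covering clause at `τ₀`).
* `stub_completeRaysSignal` (L–XL, the 'no massless hole' physics, card K4 = weak dynamical Penrose
  bound at late cuts): drain + complete `𝓘⁺` + MGHD + a radiative end ⟹ `CompleteRaysSignal 𝒟 U`.
  This is where the crux's missing "no horizon" hypothesis is paid for (route-review rreview-0815:
  "massless holes … as typed over ALL data a genuine counterexample channel").

`DrainImpliesDisperse_of (h₁ : Registered.stub_radiativeEnd) (h₂ : Registered.stub_honestEnd)
(h₃ : Registered.stub_completeRaysSignal) : Theses.BondiDrainDispersal.DrainImpliesDisperse` is PROVED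
below: the `N = 0` decomposition `dispersal` with `flatDomain = ⊤`, `flatChart = Ψ` (the explicit-chart
form of `FinalStateDecomposition.ofConvergesToMinkowski`), `charted = U`, `certifiedLate = Ψ{x⁰ > τ₁}`,
`certifiedSlab = Ψ{x⁰ = τ₁}` (all `Fin 0`-unions empty), rays by
`IsNormalisedNullRayFrom.mem_causalFuture_range` (NormalisedNullRayCausal) + (H-signal) + `subset_closure`,
future orientation from the timelike clause of `RadiativeEnd` eventually in `τ ≥ τ₀`.
`lean check`: sorries ONLY in the three `stub_*`.

Disproof used: none exists for this crux (no `Cruxes/DrainImpliesDisperse/Disproof.lean`; payload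
`disproof_path` absent; `ledger crux ls` empty, 2026-08-17). Refuter crux-attack rattack-9970 (SURVIVES;
ATTACK.md on stmt-9970): live channels massless hole / luminal runaway / Burnett — the first is isolated
as `stub_completeRaysSignal`, the other two live in `stub_radiativeEnd` (rest-mass drain by design of N1;
`C²` on entire slabs). Negatives index (1 entry, UniformPhotonSphereChannels): not instantiated by any stub.
-/

noncomputable section

open scoped Manifold ContDiff Topology ENNReal
open Filter Set Topology Literature.Geometry.Lorentzian

namespace Summit.FinalStateConjecture.FinalStateConjecture.Cruxes.DrainImpliesDisperse.Birth

set_option linter.dupNamespace false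
set_option linter.unusedVariables false

/-! ## The three objects of the cut (documentation; the stubs below are stated UNFOLDED)

Reshape r1 (lead c2, 2026-08-17): the registered stub signatures no longer mention the file-local
`def`s `RadiativeEnd` / `HonestEnd` / `CompleteRaysSignal` of the birth skeleton — a stub lands under
`Theorems/` only with EXACTLY its registered signature, and a Theorems file may not declare `def … : Prop`
(vendored-fact bounce) nor import a crux workfile; so each stub is stated over tree vocabulary only
(`Minkowski.background`, `lateRegion`/`timeSlab`, `mfderiv`, `IsTimelike`/`IsFutureDirected`,
`deviationCk`, `exteriorOf`, `causalPast`/`chronologicalPast`, `IsNormalisedNullRayFrom`), exactly as the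
landed bricks of the neighbouring line `RecurrentlyFlatDisperses` are. The three objects are unchanged:

* RADIATIVE END `(τ₀, Ψ)` of `𝒟` (`Ψ : Minkowski.background.domain → M`, domain ALL of `E4`):
  (E1) `Ψ` smooth and an open embedding of the late half-space `{x⁰ > τ₀}`; (E2) PROPER: `Ψ{x⁰ ≥ τ₀}`
  closed in `M`; (E3) `Ψ{x⁰ > τ₀} ⊆ J⁺(ι X)`; (E4) `Ψ_*∂₀` future timelike on `{x⁰ ≥ τ₀}`;
  (E5) `deviationCk Minkowski.background Ψ 2 τ → 0` (sup-`C²` on entire slabs).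
* HONEST END, for `U := Ψ{x⁰ > τ₀}`, `O := exteriorOf 𝒟 U = J⁺(ι X) ∩ I⁻(U)`: (H1) `U ⊆ I⁻(U)`;
  (H2) `∀ τ₁ ≥ τ₀, O ∖ Ψ{x⁰ > τ₁} ⊆ J⁻(Ψ{x⁰ = τ₁})`. `stub_honestEnd` derives (H1)∧(H2) from
  (E1), (E2), (E4) alone (no decay, no field equation, any Cauchy development).
* COMPLETE RAYS SIGNAL to `U`: every point `γ t`, `t ≥ 0`, of every future-complete normalised null ray
  from the data lies in `I⁻(U)` (no horizon relative to the end).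

Reshape r2 (lead c2, after wave 1): `stub_honestEnd` LANDED (p145624,
`Theorems.DrainImpliesDisperse.stub_honestEnd`, file `Theorems/BondiDrainDispersalDrainImpliesDisperseStubHonestEnd.lean`)
and is discharged below BY NAME. `stub_completeRaysSignal` came back `stub-misstated` (worker verdict, Lean-checked
in `work/stubs/stub_completeRaysSignal_corrected.lean`): as typed nothing links a complete ray that never meets
`Ψ(E4)` to `U` — (E1)–(E5) speak of `Ψ` only, the sojourn clause is satisfied by a complete ray with no location
information, the drain is existential in surfaces, maximality concerns other developments; the residual goal is
exactly the 'no massless hole' physics. The MINIMAL honest correction is the no-horizon clause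
(E6) `J⁺(ι X) ⊆ I⁻(U)` (under the route's ray-theoretic horizonless hypothesis `H` of `CensoredHorizonlessDisperse`
the registered conclusion `C` is EQUIVALENT to (E6): `raysSignal_iff_causalFuture_subset_of_horizonless`), and with
(E6) the signal property is one term (`IsNormalisedNullRayFrom.mem_causalFuture_range`). So r2 appends (E6) to the
radiative end (the engine must output a chart whose chronological past swallows the whole future of the data —
which is what "disperses, no black hole" means: then `O = exteriorOf 𝒟 U = J⁺(ι X)`), folds stub 3 into the
composition, and leaves ONE open stub: `stub_radiativeEnd` = drain + complete `𝓘⁺` + MGHD ⇒ proper,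
future-timelike-fibred, `C²`-decaying, horizonless global flat late chart — the crux's entire analytic content.

Reshape r3 (lead c5, 2026-08-17) — the REGULARITY SPLIT. Leads c2–c4 settled the status of the one open stub:
it IS the crux's analytic core (c2, promote-stub), and AS TYPED over the admissible class
`admissibleVacuumData X` (Dafermos–Rodnianski rates `o₂(r⁻¹)/o₁(r⁻²)`, i.e. `IsStronglyAsymptoticallyFlatWith
e D M 1 2 2 1`: two derivatives of `h`, one of `k` controlled at infinity) it is SUSPECT-FALSE (c3, REPORT-c3.md
= evidence REGULARITY-CHANNEL.md, kit j024863, tree fact `Literature.Analysis.PDE.not_bddAbove_deriv_deriv_focalValue`):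
`3`-dimensional focusing loses one derivative, so admissible far-field ripples `ε r⁻¹⁰ sin(r⁴) w₀` (small in
energy and in the weighted `C²₋₁` distance) focus to curvature pulses of NON-DECAYING size on the focal
worldline at times `(2πn)^{1/4} → ∞`; every honest `N = 0` slab family must pass through them (c4:
`Theorems/DrainImpliesDisperse/Negative/DrainImpliesDisperseFalseOf{Pulsed,ProperPulsed}Observer.lean`,
p155615/p157410: `¬ DrainImpliesDisperse` modulo the construction hypothesis
`ProperPulsedObserverDevelopmentExists`), contradicting (E5). The mechanism is a far-field REGULARITY
bookkeeping defect of the item, orthogonal to the route's physics; it disappears exactly for data with one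
more controlled derivative at a faster rate — Christodoulou–Klainerman's own class
`IsStronglyAsymptoticallyFlatCK = IsStronglyAsymptoticallyFlatWith e D M (3/2) (5/2) 4 3` (CQG 16 (1999)
p. A24 = CK 1993 (1.0.9); linear focusing then decays through `C³`, REPORT-c3 §2 table). Reshape r3 therefore
SPLITS the engine stub by excluded middle on the regularity of the datum:

* `stub_radiativeEnd_CK` — the SAME conclusion (E1)–(E6) for admissible data which are moreover CK-strongly
  asymptotically flat on a sole end, `∃ (e : AFEnd X) (M : ℝ), e.IsSoleEnd ∧ e.IsStronglyAsymptoticallyFlatCK D M`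
  (inserted right after `D ∈ admissibleVacuumData X`, verbatim the repair C′ of REPORT-c3 §5 R1). This is the
  PLAUSIBLE OPEN CORE: "a censored, drained MGHD of CK-admissible data converges globally, in sup-`C²` on the
  entire late slabs of a proper horizonless flat chart, to Minkowski space" — the large-data dispersal criterion,
  no theorem in print (Christodoulou–Klainerman / Bieri: small data only; Klainerman–Nicolò 2003 = tree fact
  `klainerman_nicolo_exterior_null_completeness`: far-exterior RAY completeness only, with margin `η > 0`;
  Dong–Song 2024: Riemannian; Luk–Oh 2022: its own smallness structure). It is, verbatim, the one stub of this
  line for the RESTATED crux C′, which is what the planner is asked to file.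
* `stub_radiativeEnd_rough` — the complementary case `¬ ∃ e M, e.IsSoleEnd ∧ e.IsStronglyAsymptoticallyFlatCK D M`
  (admissible data outside the CK class on every sole end). SUSPECT-FALSE (the regularity channel lives exactly
  here: c3's witnesses `(a, b) = (10, 4), (12, 5), (20, 8)` are DR-admissible and not CK); registered so that the
  crux's disprover has a NAMED target (`stub_radiativeEnd_rough_false_of_<H>` for `H` = c4's
  `ProperPulsedObserverDevelopmentExists` sharpened by "the datum is not CK on any sole end") and so that NO
  stub-prover seat is spent on it: DO NOT ATTEMPT A PROOF of `stub_radiativeEnd_rough`; its only expected fates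
  are `stub-false` (modulo a construction) or disappearance when the item is restated to C′.

The composition `DrainImpliesDisperse_of (h₁ : Registered.stub_radiativeEnd_CK) (h₂ : Registered.stub_radiativeEnd_rough)`
first reassembles the r2 statement (`radiativeEnd_of_split`, by `by_cases`) and then runs the r2 bookkeeping
verbatim. Nothing landed is touched (p145624 `stub_honestEnd`, p149007 reduction, p150058 anti-vacuity, p156690
slab achronality, p155615/p157410 negative lemmas all stay valid word for word).
-/

/-! ## The dispersive (`N = 0`) decomposition carried by an explicit flat late chart -/

section Dispersal

variable (𝓢 : Spacetime.{0} 4) (O : Set 𝓢.carrier) (k : ℕ) (τ₀ : ℝ)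
  (Ψ : Minkowski.background.domain → 𝓢.carrier)
  (hΨ : 𝓢.IsLateChart Minkowski.background O τ₀ Ψ)
  (ht : Tendsto (fun τ ↦ 𝓢.deviationCk Minkowski.background Ψ k τ) atTop (𝓝 0))
  (hcov : O \ Ψ '' Minkowski.background.lateRegion τ₀ ⊆
    𝓢.metric.causalPast 𝓢.timeOrientation (Ψ '' Minkowski.background.timeSlab τ₀))

/-- The `N = 0` final-state decomposition of `O` whose flat chart is the GIVEN late chart `Ψ` on all of
`E4` (the explicit-chart form of `FinalStateDecomposition.ofConvergesToMinkowski`, which hides the chart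
behind choice): no holes, `flatDomain = ⊤`, `flatChart = Ψ`, covering clause `hcov`.
Christodoulou–Klainerman 1993, Thm. 1.0.2. [cite: ChristodoulouKlainerman1993, Thm. 1.0.2] -/
def dispersal : FinalStateDecomposition 𝓢 O k where
  N := 0
  mass := Fin.elim0
  spin := Fin.elim0
  mass_pos i := i.elim0
  abs_spin_le_mass i := i.elim0
  motion := Fin.elim0
  τ₀ := τ₀
  chart i := i.elim0
  isLateChart i := i.elim0
  tendsto_truncDeviationCk i := i.elim0
  exists_pairwise_disjoint _ := ⟨0, fun i ↦ i.elim0⟩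
  excision := Fin.elim0
  tendsto_excision_div i := i.elim0
  flatDomain := ⊤
  setOf_lt_excision_subset_flatDomain _ _ := trivial
  flatChart := Ψ
  isLateChart_flat := hΨ
  tendsto_deviationCk_flat := ht
  diff_subset_causalPast := by
    rw [Set.iUnion_of_empty, Set.empty_union, Set.iUnion_of_empty, Set.empty_union]
    exact hcov

/-- `dispersal` has no black hole. [folklore] -/
@[simp] theorem dispersal_N : (dispersal 𝓢 O k τ₀ Ψ hΨ ht hcov).N = 0 := rfl

/-- `dispersal` starts at the chart time `τ₀`. [folklore] -/
@[simp] theorem dispersal_τ₀ : (dispersal 𝓢 O k τ₀ Ψ hΨ ht hcov).τ₀ = τ₀ := rfl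

/-- The charted late region of `dispersal` is the late image `Ψ{x⁰ > τ₀}` (no hole regions). [folklore] -/
theorem charted_dispersal :
    (dispersal 𝓢 O k τ₀ Ψ hΨ ht hcov).charted = Ψ '' Minkowski.background.lateRegion τ₀ := by
  haveI : IsEmpty (Fin (dispersal 𝓢 O k τ₀ Ψ hΨ ht hcov).N) := Fin.isEmpty'
  rw [FinalStateDecomposition.charted, Set.iUnion_of_empty, Set.union_empty]
  rfl

/-- The certified late region of `dispersal` after `τ₁` is `Ψ{x⁰ > τ₁}` (no near zones). [folklore] -/
theorem certifiedLate_dispersal (R : Fin (dispersal 𝓢 O k τ₀ Ψ hΨ ht hcov).N → ℝ → ℝ) (τ₁ : ℝ) :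
    certifiedLate (dispersal 𝓢 O k τ₀ Ψ hΨ ht hcov) R τ₁ =
      Ψ '' Minkowski.background.lateRegion τ₁ := by
  haveI : IsEmpty (Fin (dispersal 𝓢 O k τ₀ Ψ hΨ ht hcov).N) := Fin.isEmpty'
  rw [certifiedLate, Set.iUnion_of_empty, Set.union_empty]
  rfl

/-- The certified slab of `dispersal` at `τ₁` is `Ψ{x⁰ = τ₁}` (no truncated Kerr–Schild slabs). [folklore] -/
theorem certifiedSlab_dispersal (R : Fin (dispersal 𝓢 O k τ₀ Ψ hΨ ht hcov).N → ℝ → ℝ) (τ₁ : ℝ) :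
    certifiedSlab (dispersal 𝓢 O k τ₀ Ψ hΨ ht hcov) R τ₁ =
      Ψ '' Minkowski.background.timeSlab τ₁ := by
  haveI : IsEmpty (Fin (dispersal 𝓢 O k τ₀ Ψ hΨ ht hcov).N) := Fin.isEmpty'
  rw [certifiedSlab, Set.iUnion_of_empty, Set.union_empty]
  rfl

end Dispersal

/-! ## The registered stubs (UNFOLDED signatures, reshape r1/r2/r3) -/

/-- **Registered stub 1a — the radiative end of a censored drained MGHD of CK-ADMISSIBLE data** (XL,
HARDEST; reshape r3; the dispersal engine of card pmt-almost-rigidity-bubbles-are-holes, K1–K3, on the repaired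
data class). For every admissible datum `D` which is moreover Christodoulou–Klainerman strongly asymptotically
flat on a sole end (`h = (1 + 2M/r) δ + o₄(r^{-3/2})`, `k = o₃(r^{-5/2})`: `∃ e M, e.IsSoleEnd ∧
e.IsStronglyAsymptoticallyFlatCK D M`; CQG 16 (1999) p. A24 = CK 1993 (1.0.9)) and every maximal vacuum Cauchy
development `𝒟` of `D` with complete future null infinity (sojourn form) whose final Bondi mass vanishes, there
is a radiative end `(τ₀, Ψ)`: (E1) `Ψ : E4 → M` smooth, an open embedding of `{x⁰ > τ₀}`; (E2) `Ψ{x⁰ ≥ τ₀}`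
closed; (E3) `Ψ{x⁰ > τ₀} ⊆ J⁺(ι X)`; (E4) `Ψ_*∂₀` future timelike on `{x⁰ ≥ τ₀}`; (E5)
`deviationCk Minkowski.background Ψ 2 τ → 0` (sup-`C²` on ENTIRE slabs); (E6) NO HORIZON relative to the end,
`J⁺(ι X) ⊆ I⁻(Ψ{x⁰ > τ₀})`. Intended proof (card): vanishing final Bondi REST mass ⟹ late asymptotically
hyperboloidal slices of small mass; Dong–Song positive-mass STABILITY (doi:10.1007/s00222-024-01302-z)
transplanted to those slices gives flatness modulo excised bubbles of vanishing neck area; in VACUUM a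
small-neck bubble hides a MOTS or is scale-critically `L²`-curvature-small and disperses (arXiv:1204.1767,
arXiv:1409.6270); weak-to-`C²` upgrade and the global chart with decay on ENTIRE slabs = the large-data
dispersive endgame (Luk–Oh doi:10.1007/s00023-021-01148-8; Lindblad–Rodnianski); the far part of the slabs
from Klainerman–Nicolò exterior stability (tree fact `klainerman_nicolo_exterior_null_completeness` gives only
ray completeness, with margin). Why it might fail: `M_B ↓ 0` gives no pointwise control — Burnett-type
developments drain with `‖Riem‖_{L²} → ∞` (only `C⁰/H¹` flatness), AH PMT stability is known only in symmetry,
a luminal runaway is excluded only by the REST-mass reading of N1, and (E2)∧(E6) might fail jointly in a drained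
development all of whose interior rays are incomplete (massless hole). With CK regularity the far-field
focusing channel of c3 is CLOSED (linear focusing decays through `C³`). This stub IS the open-problem content of
the (restated) crux. Sources: DongSong2024, HirschKazarasKhuri2022, LukOh2022, KlainermanNicolo2003,
arXiv:1907.10743, ChristodoulouKlainerman1993, Christodoulou1999. -/
theorem stub_radiativeEnd_CK :
  ∀ (X : Type) [TopologicalSpace X] [ChartedSpace E3 X] [IsManifold (𝓡 3) ∞ X] [T2Space X]
    [SecondCountableTopology X] [ConnectedSpace X],
    ∀ D ∈ admissibleVacuumData X,
      (∃ (e : AFEnd X) (M : ℝ), e.IsSoleEnd ∧ e.IsStronglyAsymptoticallyFlatCK D M) →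
      ∀ 𝒟 : VacuumCauchyDevelopment D, 𝒟.IsMaximal →
      Summit.FinalStateConjecture.HasCompleteNullInfinity 𝒟.toCauchyDevelopment →
      𝒟.toCauchyDevelopment.HasVanishingFinalBondiMass →
      ∃ (τ₀ : ℝ) (Ψ : Minkowski.background.domain → 𝒟.carrier),
        ContMDiff 𝓘(ℝ, E4) (𝓡 4) ∞ Ψ ∧
        IsOpenEmbedding ((Minkowski.background.lateRegion τ₀).restrict Ψ) ∧
        IsClosed (Ψ '' {x : Minkowski.background.domain | τ₀ ≤ x.1 0}) ∧
        Ψ '' Minkowski.background.lateRegion τ₀ ⊆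
          𝒟.metric.causalFuture 𝒟.timeOrientation (range 𝒟.embed) ∧
        (∀ x : Minkowski.background.domain, τ₀ ≤ x.1 0 →
          𝒟.metric.IsTimelike (mfderiv 𝓘(ℝ, E4) (𝓡 4) Ψ x (E4.basisVector 0)) ∧
          𝒟.timeOrientation.IsFutureDirected (mfderiv 𝓘(ℝ, E4) (𝓡 4) Ψ x (E4.basisVector 0))) ∧
        Tendsto (fun τ ↦ 𝒟.toSpacetime.deviationCk Minkowski.background Ψ 2 τ) atTop (𝓝 0) ∧
        𝒟.metric.causalFuture 𝒟.timeOrientation (range 𝒟.embed) ⊆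
          𝒟.metric.chronologicalPast 𝒟.timeOrientation (Ψ '' Minkowski.background.lateRegion τ₀) := by
  sorry

/-- **Registered stub 1b — the radiative end for ROUGH admissible data** (reshape r3; SUSPECT-FALSE — DO NOT
ATTEMPT A PROOF; registered as the disprover's named target). The same conclusion (E1)–(E6) for admissible
data which are NOT CK-strongly asymptotically flat on any sole end (two derivatives of `h` and one of `k`
controlled at the Dafermos–Rodnianski rates, but not four resp. three at the Christodoulou–Klainerman rates).
Why it is expected to be FALSE (lead c3, REPORT-c3.md; kernel-checked linear core
`Literature.Analysis.PDE.not_bddAbove_deriv_deriv_focalValue`, p151008; kit j024863): the time-symmetric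
conformally flat-to-TT datum with far tail `ε r⁻¹⁰ sin(r⁴) w₀` is admissible (`o₂(r⁻¹)`-small, arbitrarily small
energy and mass) and not CK (`∂³h ≍ r⁻¹`); by John's focusing law `u_tt(t, 0) = 2F‴(t)` its (linearised)
development carries curvature pulses of size `≍ 64 ε` at the focal worldline at all times `(2πn)^{1/4}`, so no
flat chart through those events is `C²`-quiet there, while every honest `N = 0` slab family reaches them (c4:
p155615/p157410, `¬ DrainImpliesDisperse` modulo `ProperPulsedObserverDevelopmentExists`); (E5) fails for every
candidate `Ψ`. The nonlinear transfer (a small-data TRACKING statement in every norm but weighted `C³`) is the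
only non-rigorous step and is uncontroversial in direction (Burnett / Huneau–Luk / Luk–Rodnianski / Touati
high-frequency regime, negligible back-reaction `A_f² ω² → 0`). Fates: `stub-false` modulo a
construction hypothesis — CERTIFIED by lead c5 (p162967,
`Theorems/DrainImpliesDisperse/Negative/DrainImpliesDisperseFalseOfRoughFramedAxisPulses.lean`,
`Negative.stub_radiativeEnd_rough_false_of_roughFramedAxisPulsesDevelopmentExists : RoughFramedAxisPulsesDevelopmentExists →
¬ <this signature verbatim>`, where the hypothesis is a drained censored MGHD of a ROUGH admissible datum with a
global `C⁰`-near-Minkowski frame whose time axis is ray-borne and recurrently `C²`-pulsed; chain p160925 Hadamard /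
p161225 frame estimates / p162240 framed properness / p162401 / p162717) — or disappearance when the planner
restates the item to C′ (REPORT-c3 §5 R1; then this case is EMPTY and `stub_radiativeEnd_CK` is the whole
engine). Sources: John1982 (Ch. 5 §1), DafermosRodnianski2008 (App. B), Burnett1989, HuneauLuk2018,
LukRodnianski2020, Touati2024, Maxwell2006. -/
theorem stub_radiativeEnd_rough :
  ∀ (X : Type) [TopologicalSpace X] [ChartedSpace E3 X] [IsManifold (𝓡 3) ∞ X] [T2Space X]
    [SecondCountableTopology X] [ConnectedSpace X],
    ∀ D ∈ admissibleVacuumData X,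
      ¬ (∃ (e : AFEnd X) (M : ℝ), e.IsSoleEnd ∧ e.IsStronglyAsymptoticallyFlatCK D M) →
      ∀ 𝒟 : VacuumCauchyDevelopment D, 𝒟.IsMaximal →
      Summit.FinalStateConjecture.HasCompleteNullInfinity 𝒟.toCauchyDevelopment →
      𝒟.toCauchyDevelopment.HasVanishingFinalBondiMass →
      ∃ (τ₀ : ℝ) (Ψ : Minkowski.background.domain → 𝒟.carrier),
        ContMDiff 𝓘(ℝ, E4) (𝓡 4) ∞ Ψ ∧
        IsOpenEmbedding ((Minkowski.background.lateRegion τ₀).restrict Ψ) ∧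
        IsClosed (Ψ '' {x : Minkowski.background.domain | τ₀ ≤ x.1 0}) ∧
        Ψ '' Minkowski.background.lateRegion τ₀ ⊆
          𝒟.metric.causalFuture 𝒟.timeOrientation (range 𝒟.embed) ∧
        (∀ x : Minkowski.background.domain, τ₀ ≤ x.1 0 →
          𝒟.metric.IsTimelike (mfderiv 𝓘(ℝ, E4) (𝓡 4) Ψ x (E4.basisVector 0)) ∧
          𝒟.timeOrientation.IsFutureDirected (mfderiv 𝓘(ℝ, E4) (𝓡 4) Ψ x (E4.basisVector 0))) ∧
        Tendsto (fun τ ↦ 𝒟.toSpacetime.deviationCk Minkowski.background Ψ 2 τ) atTop (𝓝 0) ∧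
        𝒟.metric.causalFuture 𝒟.timeOrientation (range 𝒟.embed) ⊆
          𝒟.metric.chronologicalPast 𝒟.timeOrientation (Ψ '' Minkowski.background.lateRegion τ₀) := by
  sorry

/-- **Registered stub 2 — honesty of a proper future-timelike-fibred chart** (M–L, causal geometry; LANDED
p145624 as `Theorems.DrainImpliesDisperse.stub_honestEnd`, reshape r2 discharges it by name). For EVERY Cauchy development
`𝒟`, every `τ₀` and every `Ψ : E4 → M` which is smooth (E1a), an open embedding of `{x⁰ > τ₀}` (E1b), proper
on `{x⁰ ≥ τ₀}` (E2: `Ψ{x⁰ ≥ τ₀}` closed) and future-timelike-fibred there (E4), with `U := Ψ{x⁰ > τ₀}`: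
(H1) `U ⊆ I⁻(U)` — the chart line `s ↦ Ψ(x + s e₀)`, `s ∈ [0, 1]`, is a future timelike curve by (E4)
(chain rule: its velocity is `mfderiv Ψ (x + s e₀) e₀`), so `Ψ x ≪ Ψ(x + e₀) ∈ U`; (H2) for `τ₁ ≥ τ₀` and
`p ∈ (J⁺(ι X) ∩ I⁻(U)) ∖ Ψ{x⁰ > τ₁}`: if `p = Ψ x` with `τ₀ ≤ x⁰` then `x⁰ ≤ τ₁` and the chart line from
`x` to `(τ₁, x̲)` is future causal, so `p ∈ J⁻(Ψ{x⁰ = τ₁})`; otherwise `p ∉ C := Ψ{x⁰ ≥ τ₀} ⊇ U`, and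
`p ∈ I⁻(U)` gives a (τ.reverse-future = past-directed) timelike `γ : [a, b] → M`, `γ a = q ∈ U`, `γ b = p`,
continuous on `[a, b]`; the LAST CONTACT `s* = sup {s ∈ [a,b] | γ s ∈ C}` has `γ s* ∈ C` (closed, (E2)),
`s* < b`, and `γ s* ∉ U` (open, (E1b): else `γ s ∈ U ⊆ C` for `s > s*` near `s*`), so `γ s* = Ψ y` with
`y⁰ = τ₀`, and `p ≤ γ s* ≤ Ψ(τ₁, y̲) ∈ Ψ{x⁰ = τ₁}` by the chart line and transitivity
(`causalFuture_causalFuture_eq` for `τ.reverse`; O'Neill 1983, Ch. 14, p. 402). Sizes: chart lines as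
causal curves (`IsFutureCausalCurveOn.comp_of_hasDerivAt`-style chain rule), a sup/first-exit argument along
a continuous curve, curve reversal `mem_causalPast_of_mem_causalFuture`-style. Sources: ONeill1983
(Ch. 14, pp. 402–404), HawkingEllis1973 (§6.2). -/
theorem stub_honestEnd :
  ∀ (X : Type) [TopologicalSpace X] [ChartedSpace E3 X] [IsManifold (𝓡 3) ∞ X] [ConnectedSpace X]
    (D : InitialDataSet (𝓡 3) X) (𝒟 : CauchyDevelopment D) (τ₀ : ℝ)
    (Ψ : Minkowski.background.domain → 𝒟.carrier),
    ContMDiff 𝓘(ℝ, E4) (𝓡 4) ∞ Ψ →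
    IsOpenEmbedding ((Minkowski.background.lateRegion τ₀).restrict Ψ) →
    IsClosed (Ψ '' {x : Minkowski.background.domain | τ₀ ≤ x.1 0}) →
    (∀ x : Minkowski.background.domain, τ₀ ≤ x.1 0 →
      𝒟.metric.IsTimelike (mfderiv 𝓘(ℝ, E4) (𝓡 4) Ψ x (E4.basisVector 0)) ∧
      𝒟.timeOrientation.IsFutureDirected (mfderiv 𝓘(ℝ, E4) (𝓡 4) Ψ x (E4.basisVector 0))) →
    Ψ '' Minkowski.background.lateRegion τ₀ ⊆
      𝒟.metric.chronologicalPast 𝒟.timeOrientation (Ψ '' Minkowski.background.lateRegion τ₀) ∧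
    ∀ τ₁ : ℝ, τ₀ ≤ τ₁ →
      exteriorOf 𝒟 (Ψ '' Minkowski.background.lateRegion τ₀) \
          Ψ '' Minkowski.background.lateRegion τ₁ ⊆
        𝒟.metric.causalPast 𝒟.timeOrientation (Ψ '' Minkowski.background.timeSlab τ₁) :=
  -- LANDED (p145624): discharged BY NAME from the tree
  Theorems.DrainImpliesDisperse.stub_honestEnd

/-! Stub 3 of the birth skeleton (`stub_completeRaysSignal`) is FOLDED in reshape r2: with (E6) the signal
property of complete rays is the one-liner `hE6 (hγ.mem_causalFuture_range ht ht0)` inside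
`DrainImpliesDisperse_of` (worker verdict `stub-misstated`, corrected statement Lean-checked locally). -/

/-! ## Registered stub signatures (by name, for `ledger skeleton check` / `#h21_check_skeleton`)

Each `Registered.stub_<name>` is the statement of the theorem `stub_<name>` above, verbatim, so that the
composition `DrainImpliesDisperse_of` takes its hypotheses BY NAME (v5 skeleton convention); `stub_honestEnd`
is closed (landed); since reshape r3 the open stubs are `stub_radiativeEnd_CK` (plausible open core) and
`stub_radiativeEnd_rough` (suspect-false residue), and `stub_radiativeEnd` is their reassembly. -/
namespace Registered

/-- Registered signature of `stub_radiativeEnd_CK` (verbatim; reshape r3). -/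
abbrev stub_radiativeEnd_CK : Prop :=
  ∀ (X : Type) [TopologicalSpace X] [ChartedSpace E3 X] [IsManifold (𝓡 3) ∞ X] [T2Space X]
    [SecondCountableTopology X] [ConnectedSpace X],
    ∀ D ∈ admissibleVacuumData X,
      (∃ (e : AFEnd X) (M : ℝ), e.IsSoleEnd ∧ e.IsStronglyAsymptoticallyFlatCK D M) →
      ∀ 𝒟 : VacuumCauchyDevelopment D, 𝒟.IsMaximal →
      Summit.FinalStateConjecture.HasCompleteNullInfinity 𝒟.toCauchyDevelopment →
      𝒟.toCauchyDevelopment.HasVanishingFinalBondiMass →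
      ∃ (τ₀ : ℝ) (Ψ : Minkowski.background.domain → 𝒟.carrier),
        ContMDiff 𝓘(ℝ, E4) (𝓡 4) ∞ Ψ ∧
        IsOpenEmbedding ((Minkowski.background.lateRegion τ₀).restrict Ψ) ∧
        IsClosed (Ψ '' {x : Minkowski.background.domain | τ₀ ≤ x.1 0}) ∧
        Ψ '' Minkowski.background.lateRegion τ₀ ⊆
          𝒟.metric.causalFuture 𝒟.timeOrientation (range 𝒟.embed) ∧
        (∀ x : Minkowski.background.domain, τ₀ ≤ x.1 0 →
          𝒟.metric.IsTimelike (mfderiv 𝓘(ℝ, E4) (𝓡 4) Ψ x (E4.basisVector 0)) ∧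
          𝒟.timeOrientation.IsFutureDirected (mfderiv 𝓘(ℝ, E4) (𝓡 4) Ψ x (E4.basisVector 0))) ∧
        Tendsto (fun τ ↦ 𝒟.toSpacetime.deviationCk Minkowski.background Ψ 2 τ) atTop (𝓝 0) ∧
        𝒟.metric.causalFuture 𝒟.timeOrientation (range 𝒟.embed) ⊆
          𝒟.metric.chronologicalPast 𝒟.timeOrientation (Ψ '' Minkowski.background.lateRegion τ₀)

/-- Registered signature of `stub_radiativeEnd_rough` (verbatim; reshape r3). -/
abbrev stub_radiativeEnd_rough : Prop :=
  ∀ (X : Type) [TopologicalSpace X] [ChartedSpace E3 X] [IsManifold (𝓡 3) ∞ X] [T2Space X]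
    [SecondCountableTopology X] [ConnectedSpace X],
    ∀ D ∈ admissibleVacuumData X,
      ¬ (∃ (e : AFEnd X) (M : ℝ), e.IsSoleEnd ∧ e.IsStronglyAsymptoticallyFlatCK D M) →
      ∀ 𝒟 : VacuumCauchyDevelopment D, 𝒟.IsMaximal →
      Summit.FinalStateConjecture.HasCompleteNullInfinity 𝒟.toCauchyDevelopment →
      𝒟.toCauchyDevelopment.HasVanishingFinalBondiMass →
      ∃ (τ₀ : ℝ) (Ψ : Minkowski.background.domain → 𝒟.carrier),
        ContMDiff 𝓘(ℝ, E4) (𝓡 4) ∞ Ψ ∧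
        IsOpenEmbedding ((Minkowski.background.lateRegion τ₀).restrict Ψ) ∧
        IsClosed (Ψ '' {x : Minkowski.background.domain | τ₀ ≤ x.1 0}) ∧
        Ψ '' Minkowski.background.lateRegion τ₀ ⊆
          𝒟.metric.causalFuture 𝒟.timeOrientation (range 𝒟.embed) ∧
        (∀ x : Minkowski.background.domain, τ₀ ≤ x.1 0 →
          𝒟.metric.IsTimelike (mfderiv 𝓘(ℝ, E4) (𝓡 4) Ψ x (E4.basisVector 0)) ∧
          𝒟.timeOrientation.IsFutureDirected (mfderiv 𝓘(ℝ, E4) (𝓡 4) Ψ x (E4.basisVector 0))) ∧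
        Tendsto (fun τ ↦ 𝒟.toSpacetime.deviationCk Minkowski.background Ψ 2 τ) atTop (𝓝 0) ∧
        𝒟.metric.causalFuture 𝒟.timeOrientation (range 𝒟.embed) ⊆
          𝒟.metric.chronologicalPast 𝒟.timeOrientation (Ψ '' Minkowski.background.lateRegion τ₀)

/-- The r2 engine statement `stub_radiativeEnd` (no longer a stub: derived from the split by `radiativeEnd_of_split`;
kept verbatim because it is the hypothesis of the landed glue p149007). -/
abbrev stub_radiativeEnd : Prop :=
  ∀ (X : Type) [TopologicalSpace X] [ChartedSpace E3 X] [IsManifold (𝓡 3) ∞ X] [T2Space X]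
    [SecondCountableTopology X] [ConnectedSpace X],
    ∀ D ∈ admissibleVacuumData X, ∀ 𝒟 : VacuumCauchyDevelopment D, 𝒟.IsMaximal →
      Summit.FinalStateConjecture.HasCompleteNullInfinity 𝒟.toCauchyDevelopment →
      𝒟.toCauchyDevelopment.HasVanishingFinalBondiMass →
      ∃ (τ₀ : ℝ) (Ψ : Minkowski.background.domain → 𝒟.carrier),
        ContMDiff 𝓘(ℝ, E4) (𝓡 4) ∞ Ψ ∧
        IsOpenEmbedding ((Minkowski.background.lateRegion τ₀).restrict Ψ) ∧
        IsClosed (Ψ '' {x : Minkowski.background.domain | τ₀ ≤ x.1 0}) ∧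
        Ψ '' Minkowski.background.lateRegion τ₀ ⊆
          𝒟.metric.causalFuture 𝒟.timeOrientation (range 𝒟.embed) ∧
        (∀ x : Minkowski.background.domain, τ₀ ≤ x.1 0 →
          𝒟.metric.IsTimelike (mfderiv 𝓘(ℝ, E4) (𝓡 4) Ψ x (E4.basisVector 0)) ∧
          𝒟.timeOrientation.IsFutureDirected (mfderiv 𝓘(ℝ, E4) (𝓡 4) Ψ x (E4.basisVector 0))) ∧
        Tendsto (fun τ ↦ 𝒟.toSpacetime.deviationCk Minkowski.background Ψ 2 τ) atTop (𝓝 0) ∧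
        𝒟.metric.causalFuture 𝒟.timeOrientation (range 𝒟.embed) ⊆
          𝒟.metric.chronologicalPast 𝒟.timeOrientation (Ψ '' Minkowski.background.lateRegion τ₀)

/-- Registered signature of `stub_honestEnd` (verbatim). -/
abbrev stub_honestEnd : Prop :=
  ∀ (X : Type) [TopologicalSpace X] [ChartedSpace E3 X] [IsManifold (𝓡 3) ∞ X] [ConnectedSpace X]
    (D : InitialDataSet (𝓡 3) X) (𝒟 : CauchyDevelopment D) (τ₀ : ℝ)
    (Ψ : Minkowski.background.domain → 𝒟.carrier),
    ContMDiff 𝓘(ℝ, E4) (𝓡 4) ∞ Ψ →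
    IsOpenEmbedding ((Minkowski.background.lateRegion τ₀).restrict Ψ) →
    IsClosed (Ψ '' {x : Minkowski.background.domain | τ₀ ≤ x.1 0}) →
    (∀ x : Minkowski.background.domain, τ₀ ≤ x.1 0 →
      𝒟.metric.IsTimelike (mfderiv 𝓘(ℝ, E4) (𝓡 4) Ψ x (E4.basisVector 0)) ∧
      𝒟.timeOrientation.IsFutureDirected (mfderiv 𝓘(ℝ, E4) (𝓡 4) Ψ x (E4.basisVector 0))) →
    Ψ '' Minkowski.background.lateRegion τ₀ ⊆
      𝒟.metric.chronologicalPast 𝒟.timeOrientation (Ψ '' Minkowski.background.lateRegion τ₀) ∧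
    ∀ τ₁ : ℝ, τ₀ ≤ τ₁ →
      exteriorOf 𝒟 (Ψ '' Minkowski.background.lateRegion τ₀) \
          Ψ '' Minkowski.background.lateRegion τ₁ ⊆
        𝒟.metric.causalPast 𝒟.timeOrientation (Ψ '' Minkowski.background.timeSlab τ₁)

end Registered

/-- **The r2 engine statement, reassembled from the regularity split** (reshape r3; excluded middle on
`∃ e M, e.IsSoleEnd ∧ e.IsStronglyAsymptoticallyFlatCK D M`; no `sorry` of its own). This is verbatim the
hypothesis of the landed glue theorem `Theorems.DrainImpliesDisperse.drainImpliesDisperse_of_horizonlessRadiativeEnd`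
(p149007). [folklore] -/
theorem radiativeEnd_of_split (h₁ : Registered.stub_radiativeEnd_CK) (h₂ : Registered.stub_radiativeEnd_rough) :
  ∀ (X : Type) [TopologicalSpace X] [ChartedSpace E3 X] [IsManifold (𝓡 3) ∞ X] [T2Space X]
    [SecondCountableTopology X] [ConnectedSpace X],
    ∀ D ∈ admissibleVacuumData X, ∀ 𝒟 : VacuumCauchyDevelopment D, 𝒟.IsMaximal →
      Summit.FinalStateConjecture.HasCompleteNullInfinity 𝒟.toCauchyDevelopment →
      𝒟.toCauchyDevelopment.HasVanishingFinalBondiMass →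
      ∃ (τ₀ : ℝ) (Ψ : Minkowski.background.domain → 𝒟.carrier),
        ContMDiff 𝓘(ℝ, E4) (𝓡 4) ∞ Ψ ∧
        IsOpenEmbedding ((Minkowski.background.lateRegion τ₀).restrict Ψ) ∧
        IsClosed (Ψ '' {x : Minkowski.background.domain | τ₀ ≤ x.1 0}) ∧
        Ψ '' Minkowski.background.lateRegion τ₀ ⊆
          𝒟.metric.causalFuture 𝒟.timeOrientation (range 𝒟.embed) ∧
        (∀ x : Minkowski.background.domain, τ₀ ≤ x.1 0 →
          𝒟.metric.IsTimelike (mfderiv 𝓘(ℝ, E4) (𝓡 4) Ψ x (E4.basisVector 0)) ∧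
          𝒟.timeOrientation.IsFutureDirected (mfderiv 𝓘(ℝ, E4) (𝓡 4) Ψ x (E4.basisVector 0))) ∧
        Tendsto (fun τ ↦ 𝒟.toSpacetime.deviationCk Minkowski.background Ψ 2 τ) atTop (𝓝 0) ∧
        𝒟.metric.causalFuture 𝒟.timeOrientation (range 𝒟.embed) ⊆
          𝒟.metric.chronologicalPast 𝒟.timeOrientation (Ψ '' Minkowski.background.lateRegion τ₀) := by
  intro X _ _ _ _ _ _ D hD 𝒟 h𝒟 hI hB
  by_cases hCK : ∃ (e : AFEnd X) (M : ℝ), e.IsSoleEnd ∧ e.IsStronglyAsymptoticallyFlatCK D M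
  · exact h₁ X D hD hCK 𝒟 h𝒟 hI hB
  · exact h₂ X D hD hCK 𝒟 h𝒟 hI hB


/-- The registered signatures ARE the statements of the `stub_*` theorems (checked by ascription;
these `example`s elaborate no `sorry` of their own). -/
example : Registered.stub_radiativeEnd_CK := stub_radiativeEnd_CK
example : Registered.stub_radiativeEnd_rough := stub_radiativeEnd_rough
example : Registered.stub_radiativeEnd := radiativeEnd_of_split stub_radiativeEnd_CK stub_radiativeEnd_rough
example : Registered.stub_honestEnd := stub_honestEnd

/-! ## The composition: the crux BY NAME from the open stub statement (no `sorry`; the landed stub is used by name) -/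

/-- **`DrainImpliesDisperse` from the two open stubs, BY NAME** (reshape r2/r3). Given the drained, censored MGHD `𝒟`
of an admissible datum: stubs 1a/1b (reassembled by `radiativeEnd_of_split`) supply a horizonless radiative end `(τ₀, Ψ)` ((E1)–(E6)), the LANDED stub 2
(`stub_honestEnd`, discharged inside the proof) its honesty (H1)/(H2) from (E1), (E2), (E4); the signal property of complete rays is (E6) after
`IsNormalisedNullRayFrom.mem_causalFuture_range`. Put `U := Ψ{x⁰ > τ₀}`,
`O := exteriorOf 𝒟 U`. Then `Ψ` is a late chart into `O` ((E1), (E3), (H1)), the covering clause at `τ₀`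
is (H2) at `τ₁ = τ₀`, and `d := dispersal …` is an `N = 0` decomposition of `O` in `C²` with: `d.N = 0`
(`rfl`); `O = exteriorOf 𝒟 d.charted` (`charted_dispersal`); `RaysStayInClosure 𝒟 O` — a ray point
`γ t`, `t ≥ 0`, lies in `J⁺(ι X)` (`IsNormalisedNullRayFrom.mem_causalFuture_range`) and hence in `I⁻(U)`
by (E6), i.e. in `O ⊆ closure O`; `HasExhaustiveCharts d` with `R := Fin.elim0` — (H2) at `τ₁ > τ₀`
after `certifiedLate_dispersal`/`certifiedSlab_dispersal`; `IsFutureOriented d` — the hole clauses are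
vacuous over `Fin 0` and the flat clause is (E4) eventually in `τ ≥ τ₀`. Pure logic and bookkeeping. -/
theorem DrainImpliesDisperse_of (h₁ : Registered.stub_radiativeEnd_CK)
    (h₂ : Registered.stub_radiativeEnd_rough) :
    Theses.BondiDrainDispersal.DrainImpliesDisperse := by
  intro X _ _ _ _ _ _ D hD 𝒟 h𝒟 hI hB
  -- reshape r3: the r2 engine statement from the regularity split (excluded middle on CK-regularity of `D`)
  obtain ⟨τ₀, Ψ, hsm, hemb, hcl, hJ, hT, hdec, hE6⟩ := radiativeEnd_of_split h₁ h₂ X D hD 𝒟 h𝒟 hI hB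
  -- stub 2 is LANDED: discharged inside the proof by name (`stub_honestEnd` above, from the tree)
  obtain ⟨hself, hexh⟩ := stub_honestEnd X D 𝒟.toCauchyDevelopment τ₀ Ψ hsm hemb hcl hT
  -- the late chart into `O := exteriorOf 𝒟 U`, `U := Ψ{x⁰ > τ₀}`
  have hlate : 𝒟.toSpacetime.IsLateChart Minkowski.background
      (exteriorOf 𝒟.toCauchyDevelopment (Ψ '' Minkowski.background.lateRegion τ₀)) τ₀ Ψ :=
    ⟨hsm, hemb, Set.subset_inter hJ hself⟩
  refine ⟨exteriorOf 𝒟.toCauchyDevelopment (Ψ '' Minkowski.background.lateRegion τ₀),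
    dispersal 𝒟.toSpacetime _ 2 τ₀ Ψ hlate hdec (hexh τ₀ le_rfl), rfl, ?_, ?_, ?_, ?_⟩
  · -- `O = exteriorOf 𝒟 d.charted`
    rw [charted_dispersal]
  · -- `RaysStayInClosure 𝒟 O`
    intro _ p γ dom hγ hdom t ht ht0
    exact subset_closure ⟨hγ.mem_causalFuture_range ht ht0, hE6 (hγ.mem_causalFuture_range ht ht0)⟩
  · -- `HasExhaustiveCharts d`
    refine ⟨fun i ↦ i.elim0, fun i ↦ i.elim0, fun i ↦ i.elim0, fun τ₁ hτ₁ ↦ ?_⟩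
    rw [certifiedLate_dispersal, certifiedSlab_dispersal]
    exact hexh τ₁ (le_of_lt hτ₁)
  · -- `IsFutureOriented d`
    refine ⟨fun i ↦ i.elim0, fun i ↦ i.elim0, ?_⟩
    filter_upwards [Filter.eventually_ge_atTop τ₀] with τ hτ x hx
    have hx' : (x.1 : E4) 0 = τ := hx
    exact (hT x (hτ.trans_eq hx'.symm)).2

/-! ## The RESTATED crux C′ (REPORT-c3 §5 R1) is closed by this line modulo `stub_radiativeEnd_CK` ALONE

For the planner (reshape r3, lead c5): the repaired statement C′ — `DrainImpliesDisperse` with the regularity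
clause `(∃ (e : AFEnd X) (M : ℝ), e.IsSoleEnd ∧ e.IsStronglyAsymptoticallyFlatCK D M)` inserted right after
`D ∈ admissibleVacuumData X` (Christodoulou, CQG 16 (1999) p. A24 = Christodoulou–Klainerman 1993 (1.0.9):
`h = (1 + 2M/r) δ + o₄(r^{-3/2})`, `k = o₃(r^{-5/2})`) — is spelled out below in the route file's fully
qualified style and PROVED from the single stub `stub_radiativeEnd_CK` through the landed reduction
`Theorems.DrainImpliesDisperse.settles_of_horizonlessRadiativeEnd` (p149007). So restating item
stmt-FinalStateConjecture-17283 (and its twin, and 17284 `CensoredHorizonlessDisperse` likewise) to C′ costs the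
line nothing: `registered` survives with ONE open stub, the plausible open core; the suspect-false
`stub_radiativeEnd_rough` simply drops out. -/

/-- **The restated crux C′ from the CK engine stub alone.** For every admissible datum which is moreover
CK-strongly asymptotically flat on a sole end and every censored, drained maximal vacuum Cauchy development of
it, the re-typed Statement's `N = 0` conclusion holds — given `stub_radiativeEnd_CK`. The statement is C′ of
`Cruxes/DrainImpliesDisperse/REPORT-c3.md` §5 (R1) verbatim (fully qualified, ready to file); the proof is the
landed reduction `settles_of_horizonlessRadiativeEnd` applied to the radiative end the stub supplies.
[cite: Christodoulou1999, p. A24] -/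
theorem DrainImpliesDisperseCK_of (h₁ : Registered.stub_radiativeEnd_CK) :
    ∀ (X : Type) [TopologicalSpace X] [ChartedSpace Literature.Geometry.Lorentzian.E3 X]
      [IsManifold (𝓡 3) ((⊤ : ℕ∞) : WithTop ℕ∞) X] [T2Space X] [SecondCountableTopology X] [ConnectedSpace X],
      ∀ D ∈ Literature.Geometry.Lorentzian.admissibleVacuumData X,
        (∃ (e : Literature.Geometry.Lorentzian.AFEnd X) (M : ℝ),
            e.IsSoleEnd ∧ e.IsStronglyAsymptoticallyFlatCK D M) →
        ∀ 𝒟 : Literature.Geometry.Lorentzian.VacuumCauchyDevelopment D, 𝒟.IsMaximal →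
          Summit.FinalStateConjecture.HasCompleteNullInfinity 𝒟.toCauchyDevelopment →
          𝒟.toCauchyDevelopment.HasVanishingFinalBondiMass →
          ∃ (O : Set 𝒟.carrier)
            (d : Literature.Geometry.Lorentzian.FinalStateDecomposition 𝒟.toSpacetime O 2),
            d.N = 0 ∧ O = Summit.FinalStateConjecture.exteriorOf 𝒟.toCauchyDevelopment d.charted ∧
              Summit.FinalStateConjecture.RaysStayInClosure 𝒟.toCauchyDevelopment O ∧
              Summit.FinalStateConjecture.HasExhaustiveCharts d ∧
              Summit.FinalStateConjecture.IsFutureOriented d := by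
  intro X _ _ _ _ _ _ D hD hCK 𝒟 h𝒟 hI hB
  obtain ⟨τ₀, Ψ, hsm, hemb, hcl, hJ, hT, hdec, hE6⟩ := h₁ X D hD hCK 𝒟 h𝒟 hI hB
  exact Theorems.DrainImpliesDisperse.settles_of_horizonlessRadiativeEnd X D 𝒟.toCauchyDevelopment τ₀ Ψ
    hsm hemb hcl hJ hT hdec hE6


/-! ## r4 (lead c6, 2026-08-17): under the restated crux C″ the no-horizon clause (E6) is localised at infinity

`Cruxes/DrainImpliesDisperse/REPORT-c6.md` recommends restating the item to **C″** = C′ + the ray-theoretic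
HORIZONLESS hypothesis of `CensoredHorizonlessDisperse` (verbatim), which the route's deciding theorem `closes` has
in context at the only place it applies this crux (`Cruxes/DrainImpliesDisperse/Surgery-c6.lean`: `closes_H`,
`closes_R4`, kernel-checked). Under C″ the engine no longer has to output (E6) `J⁺(ι X) ⊆ I⁻(Ψ{x⁰ > τ₀})` — a
statement about EVERY interior event, the 'massless hole' channel — but only that every future-COMPLETE normalised
null ray from the data signals to the late region at arbitrarily late parameters (a clause about the far parts of
the complete rays, where exterior stability operates): by the LANDED helper
`Theorems.DrainImpliesDisperse.causalFuture_subset_chronologicalPast_of_noHorizon_of_cofinal` (p166259; push-up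
`I⁻(J⁻ S) = I⁻ S` and transitivity of `≪`: `M = I⁻(𝓡) ⊆ I⁻(J⁻(I⁻ U)) ⊆ I⁻(U)`, `𝓡` the complete-ray region) the
horizonless hypothesis upgrades cofinal signalling to (E6). The composition below is kernel-checked. Its hypothesis is
the C″-ENGINE STATEMENT ((E1)–(E5) + cofinal signalling, CK data, censored + horizonless + drained MGHD); it is NOT
registered as a stub of the item as filed (the route cannot supply the horizonless hypothesis to the crux as filed) —
it is the one stub of this line once the item is restated to C″. -/

/-- **The restated crux C″ from a VISIBLE radiative end** (r4). If every censored, horizonless, drained MGHD of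
CK-admissible data carries `(τ₀, Ψ)` with (E1) `Ψ` smooth, an open embedding of `{x⁰ > τ₀}`, (E2) `Ψ{x⁰ ≥ τ₀}` closed,
(E3) `Ψ{x⁰ > τ₀} ⊆ J⁺(ι X)`, (E4) `Ψ_*∂₀` future timelike on `{x⁰ ≥ τ₀}`, (E5) `deviationCk … Ψ 2 τ → 0`, and
(E6♭) COFINAL SIGNALLING — along every future-complete normalised null ray `γ` from the data and for every parameter `t`
there is `t' ≥ t` with `γ t' ∈ I⁻(Ψ{x⁰ > τ₀})` — then C″ holds: the horizonless hypothesis turns (E6♭) into (E6)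
(p166259) and the landed reduction `settles_of_horizonlessRadiativeEnd` (p149007) gives the `N = 0` clause.
[cite: ONeillSemiRiemannian1983, Ch. 14, Cor. 14.1 (p. 402) and p. 403] -/
theorem DrainImpliesDisperseCKH_of_visibleRadiativeEnd
    (h : ∀ (X : Type) [TopologicalSpace X] [ChartedSpace E3 X] [IsManifold (𝓡 3) ∞ X] [T2Space X]
      [SecondCountableTopology X] [ConnectedSpace X],
      ∀ D ∈ admissibleVacuumData X,
        (∃ (e : AFEnd X) (M : ℝ), e.IsSoleEnd ∧ e.IsStronglyAsymptoticallyFlatCK D M) →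
        ∀ 𝒟 : VacuumCauchyDevelopment D, 𝒟.IsMaximal →
        Summit.FinalStateConjecture.HasCompleteNullInfinity 𝒟.toCauchyDevelopment →
        ¬ (∀ [𝒟.metric.HasLeviCivita], ∃ q : 𝒟.carrier, ∀ (p : X) (γ : ℝ → 𝒟.carrier) (dom : Set ℝ),
            𝒟.metric.IsNormalisedNullRayFrom 𝒟.timeOrientation 𝒟.embed 𝒟.normal p γ dom → ¬ BddAbove dom →
            q ∉ 𝒟.metric.chronologicalPast 𝒟.timeOrientation (γ '' (dom ∩ Set.Ici 0))) →
        𝒟.toCauchyDevelopment.HasVanishingFinalBondiMass →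
        ∃ (τ₀ : ℝ) (Ψ : Minkowski.background.domain → 𝒟.carrier),
          ContMDiff 𝓘(ℝ, E4) (𝓡 4) ∞ Ψ ∧
          IsOpenEmbedding ((Minkowski.background.lateRegion τ₀).restrict Ψ) ∧
          IsClosed (Ψ '' {x : Minkowski.background.domain | τ₀ ≤ x.1 0}) ∧
          Ψ '' Minkowski.background.lateRegion τ₀ ⊆
            𝒟.metric.causalFuture 𝒟.timeOrientation (range 𝒟.embed) ∧
          (∀ x : Minkowski.background.domain, τ₀ ≤ x.1 0 →
            𝒟.metric.IsTimelike (mfderiv 𝓘(ℝ, E4) (𝓡 4) Ψ x (E4.basisVector 0)) ∧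
            𝒟.timeOrientation.IsFutureDirected (mfderiv 𝓘(ℝ, E4) (𝓡 4) Ψ x (E4.basisVector 0))) ∧
          Tendsto (fun τ ↦ 𝒟.toSpacetime.deviationCk Minkowski.background Ψ 2 τ) atTop (𝓝 0) ∧
          (∀ [𝒟.metric.HasLeviCivita], ∀ (p : X) (γ : ℝ → 𝒟.carrier) (dom : Set ℝ),
            𝒟.metric.IsNormalisedNullRayFrom 𝒟.timeOrientation 𝒟.embed 𝒟.normal p γ dom →
              ¬ BddAbove dom → ∀ t ∈ dom, ∃ t' ∈ dom, t ≤ t' ∧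
                γ t' ∈ 𝒟.metric.chronologicalPast 𝒟.timeOrientation
                  (Ψ '' Minkowski.background.lateRegion τ₀))) :
    ∀ (X : Type) [TopologicalSpace X] [ChartedSpace Literature.Geometry.Lorentzian.E3 X]
      [IsManifold (𝓡 3) ((⊤ : ℕ∞) : WithTop ℕ∞) X] [T2Space X] [SecondCountableTopology X] [ConnectedSpace X],
      ∀ D ∈ Literature.Geometry.Lorentzian.admissibleVacuumData X,
        (∃ (e : Literature.Geometry.Lorentzian.AFEnd X) (M : ℝ),
            e.IsSoleEnd ∧ e.IsStronglyAsymptoticallyFlatCK D M) →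
        ∀ 𝒟 : Literature.Geometry.Lorentzian.VacuumCauchyDevelopment D, 𝒟.IsMaximal →
          Summit.FinalStateConjecture.HasCompleteNullInfinity 𝒟.toCauchyDevelopment →
          ¬ (∀ [𝒟.metric.HasLeviCivita], ∃ q : 𝒟.carrier, ∀ (p : X) (γ : ℝ → 𝒟.carrier) (dom : Set ℝ),
              𝒟.metric.IsNormalisedNullRayFrom 𝒟.timeOrientation 𝒟.embed 𝒟.normal p γ dom → ¬ BddAbove dom →
              q ∉ 𝒟.metric.chronologicalPast 𝒟.timeOrientation (γ '' (dom ∩ Set.Ici 0))) →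
          𝒟.toCauchyDevelopment.HasVanishingFinalBondiMass →
          ∃ (O : Set 𝒟.carrier)
            (d : Literature.Geometry.Lorentzian.FinalStateDecomposition 𝒟.toSpacetime O 2),
            d.N = 0 ∧ O = Summit.FinalStateConjecture.exteriorOf 𝒟.toCauchyDevelopment d.charted ∧
              Summit.FinalStateConjecture.RaysStayInClosure 𝒟.toCauchyDevelopment O ∧
              Summit.FinalStateConjecture.HasExhaustiveCharts d ∧
              Summit.FinalStateConjecture.IsFutureOriented d := by
  intro X _ _ _ _ _ _ D hD hCK 𝒟 h𝒟 hI hH hB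
  obtain ⟨τ₀, Ψ, hsm, hemb, hcl, hJ, hT, hdec, hsig⟩ := h X D hD hCK 𝒟 h𝒟 hI hH hB
  haveI : 𝒟.metric.HasLeviCivita := PseudoRiemannianMetric.hasLeviCivita _
  have hE6 := Theorems.DrainImpliesDisperse.causalFuture_subset_chronologicalPast_of_noHorizon_of_cofinal
    𝒟 hH τ₀ Ψ hsig
  exact Theorems.DrainImpliesDisperse.settles_of_horizonlessRadiativeEnd X D 𝒟.toCauchyDevelopment τ₀ Ψ
    hsm hemb hcl hJ hT hdec hE6


/-- **(E6♭) from eventual containment** (r4): if every future-complete normalised null ray from the data eventually STAYS in the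
late region `U = Ψ{x⁰ > τ₀}` and `U ⊆ I⁻(U)` ((H1) of the landed `stub_honestEnd`), then it signals to `U` cofinally. The form in
which exterior stability delivers the clause (an outgoing complete ray crosses every late slab). [folklore] -/
theorem cofinal_of_eventually_mem {X : Type} [TopologicalSpace X] [ChartedSpace E3 X] [IsManifold (𝓡 3) ∞ X]
    [ConnectedSpace X] {D : InitialDataSet (𝓡 3) X} (𝒟 : CauchyDevelopment D) [𝒟.metric.HasLeviCivita]
    {U : Set 𝒟.carrier} (hself : U ⊆ 𝒟.metric.chronologicalPast 𝒟.timeOrientation U)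
    (hev : ∀ (p : X) (γ : ℝ → 𝒟.carrier) (dom : Set ℝ),
      𝒟.metric.IsNormalisedNullRayFrom 𝒟.timeOrientation 𝒟.embed 𝒟.normal p γ dom →
        ¬ BddAbove dom → ∃ T : ℝ, ∀ t ∈ dom, T ≤ t → γ t ∈ U) :
    ∀ (p : X) (γ : ℝ → 𝒟.carrier) (dom : Set ℝ),
      𝒟.metric.IsNormalisedNullRayFrom 𝒟.timeOrientation 𝒟.embed 𝒟.normal p γ dom →
        ¬ BddAbove dom → ∀ t ∈ dom, ∃ t' ∈ dom, t ≤ t' ∧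
          γ t' ∈ 𝒟.metric.chronologicalPast 𝒟.timeOrientation U := by
  intro p γ dom hγ hdom t ht
  obtain ⟨T, hT⟩ := hev p γ dom hγ hdom
  -- the domain is unbounded above: pick `t' ∈ dom` beyond `max t T`
  obtain ⟨t', ht', hlt⟩ : ∃ t' ∈ dom, max t T < t' := by
    by_contra hcon
    push Not at hcon
    exact hdom ⟨max t T, fun s hs ↦ hcon s hs⟩
  exact ⟨t', ht', (le_max_left t T).trans hlt.le, hself (hT t' ht' ((le_max_right t T).trans hlt.le))⟩

/-- **The restated crux C″ from a COVERING radiative end** (r4; the most natural C″-engine statement): (E1)–(E5) and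
(E6♮) every future-complete normalised null ray from the data eventually stays in `Ψ{x⁰ > τ₀}`. (H1) `U ⊆ I⁻(U)` comes from the
landed `stub_honestEnd` (p145624), (E6♮) ⇒ (E6♭) (`cofinal_of_eventually_mem`) ⇒ (E6) under the horizonless hypothesis (p166259)
⇒ the `N = 0` clause (p149007). [cite: ONeillSemiRiemannian1983, Ch. 14, Cor. 14.1 (p. 402) and p. 403] -/
theorem DrainImpliesDisperseCKH_of_coveringRadiativeEnd
    (h : ∀ (X : Type) [TopologicalSpace X] [ChartedSpace E3 X] [IsManifold (𝓡 3) ∞ X] [T2Space X]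
      [SecondCountableTopology X] [ConnectedSpace X],
      ∀ D ∈ admissibleVacuumData X,
        (∃ (e : AFEnd X) (M : ℝ), e.IsSoleEnd ∧ e.IsStronglyAsymptoticallyFlatCK D M) →
        ∀ 𝒟 : VacuumCauchyDevelopment D, 𝒟.IsMaximal →
        Summit.FinalStateConjecture.HasCompleteNullInfinity 𝒟.toCauchyDevelopment →
        ¬ (∀ [𝒟.metric.HasLeviCivita], ∃ q : 𝒟.carrier, ∀ (p : X) (γ : ℝ → 𝒟.carrier) (dom : Set ℝ),
            𝒟.metric.IsNormalisedNullRayFrom 𝒟.timeOrientation 𝒟.embed 𝒟.normal p γ dom → ¬ BddAbove dom →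
            q ∉ 𝒟.metric.chronologicalPast 𝒟.timeOrientation (γ '' (dom ∩ Set.Ici 0))) →
        𝒟.toCauchyDevelopment.HasVanishingFinalBondiMass →
        ∃ (τ₀ : ℝ) (Ψ : Minkowski.background.domain → 𝒟.carrier),
          ContMDiff 𝓘(ℝ, E4) (𝓡 4) ∞ Ψ ∧
          IsOpenEmbedding ((Minkowski.background.lateRegion τ₀).restrict Ψ) ∧
          IsClosed (Ψ '' {x : Minkowski.background.domain | τ₀ ≤ x.1 0}) ∧
          Ψ '' Minkowski.background.lateRegion τ₀ ⊆
            𝒟.metric.causalFuture 𝒟.timeOrientation (range 𝒟.embed) ∧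
          (∀ x : Minkowski.background.domain, τ₀ ≤ x.1 0 →
            𝒟.metric.IsTimelike (mfderiv 𝓘(ℝ, E4) (𝓡 4) Ψ x (E4.basisVector 0)) ∧
            𝒟.timeOrientation.IsFutureDirected (mfderiv 𝓘(ℝ, E4) (𝓡 4) Ψ x (E4.basisVector 0))) ∧
          Tendsto (fun τ ↦ 𝒟.toSpacetime.deviationCk Minkowski.background Ψ 2 τ) atTop (𝓝 0) ∧
          (∀ [𝒟.metric.HasLeviCivita], ∀ (p : X) (γ : ℝ → 𝒟.carrier) (dom : Set ℝ),
            𝒟.metric.IsNormalisedNullRayFrom 𝒟.timeOrientation 𝒟.embed 𝒟.normal p γ dom →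
              ¬ BddAbove dom → ∃ T : ℝ, ∀ t ∈ dom, T ≤ t → γ t ∈ Ψ '' Minkowski.background.lateRegion τ₀)) :
    ∀ (X : Type) [TopologicalSpace X] [ChartedSpace Literature.Geometry.Lorentzian.E3 X]
      [IsManifold (𝓡 3) ((⊤ : ℕ∞) : WithTop ℕ∞) X] [T2Space X] [SecondCountableTopology X] [ConnectedSpace X],
      ∀ D ∈ Literature.Geometry.Lorentzian.admissibleVacuumData X,
        (∃ (e : Literature.Geometry.Lorentzian.AFEnd X) (M : ℝ),
            e.IsSoleEnd ∧ e.IsStronglyAsymptoticallyFlatCK D M) →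
        ∀ 𝒟 : Literature.Geometry.Lorentzian.VacuumCauchyDevelopment D, 𝒟.IsMaximal →
          Summit.FinalStateConjecture.HasCompleteNullInfinity 𝒟.toCauchyDevelopment →
          ¬ (∀ [𝒟.metric.HasLeviCivita], ∃ q : 𝒟.carrier, ∀ (p : X) (γ : ℝ → 𝒟.carrier) (dom : Set ℝ),
              𝒟.metric.IsNormalisedNullRayFrom 𝒟.timeOrientation 𝒟.embed 𝒟.normal p γ dom → ¬ BddAbove dom →
              q ∉ 𝒟.metric.chronologicalPast 𝒟.timeOrientation (γ '' (dom ∩ Set.Ici 0))) →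
          𝒟.toCauchyDevelopment.HasVanishingFinalBondiMass →
          ∃ (O : Set 𝒟.carrier)
            (d : Literature.Geometry.Lorentzian.FinalStateDecomposition 𝒟.toSpacetime O 2),
            d.N = 0 ∧ O = Summit.FinalStateConjecture.exteriorOf 𝒟.toCauchyDevelopment d.charted ∧
              Summit.FinalStateConjecture.RaysStayInClosure 𝒟.toCauchyDevelopment O ∧
              Summit.FinalStateConjecture.HasExhaustiveCharts d ∧
              Summit.FinalStateConjecture.IsFutureOriented d := by
  refine DrainImpliesDisperseCKH_of_visibleRadiativeEnd fun X _ _ _ _ _ _ D hD hCK 𝒟 h𝒟 hI hH hB ↦ ?_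
  obtain ⟨τ₀, Ψ, hsm, hemb, hcl, hJ, hT, hdec, hev⟩ := h X D hD hCK 𝒟 h𝒟 hI hH hB
  obtain ⟨hself, -⟩ := stub_honestEnd X D 𝒟.toCauchyDevelopment τ₀ Ψ hsm hemb hcl hT
  refine ⟨τ₀, Ψ, hsm, hemb, hcl, hJ, hT, hdec, ?_⟩
  intro _
  exact cofinal_of_eventually_mem 𝒟.toCauchyDevelopment hself hev

end Summit.FinalStateConjecture.FinalStateConjecture.Cruxes.DrainImpliesDisperse.Birth

end
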